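import Mathlib
import Summits.Ventures.HodgeRepro.Tier4.Line4.L1Class
import Summits.Ventures.HodgeRepro.Tier4.Line4.ArchProdCoeff

/-!
# Tier4/Line4/ArchFactorProd — the `arch_ne` clause for the product witnesses, KERNEL HALF: the `T′_∞`-integral of
`archFactor` FACTORS OUT as the character sum `∫_{T′_∞} conj χ′ · Wt`, so `archFactor ≠ 0 ⟸ (the matching of `χ′` with the
product weight `Wt` on `T′_∞`) ∧ (the `T_∞`-Fourier coefficient `∫_{T_∞} χ(a) archWitness(a⁻¹ γ₀) ≠ 0`)

Blind re-derivation cell `pub-hodge-repro`, Tier 4 (README §9–§10), seat t4-L1-p5 (prover, gen 5; C-L4-ARCHPROD S15149 /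
S15216; the `arch_ne` field of `IsArchCoeff`, plan-4's «PRECISION 5 per place»).  Target tree path
`lean/Summits/Ventures/HodgeRepro/Tier4/Line4/ArchFactorProd.lean`.  On plan-4's `L1Class` (p699130: `archFactor`,
`torusInf`/`torusInf'` through L2-p1's TorusProduct) and the seat's `ArchProdCoeff` (p705212) with its RIGHT laws
(`D3coeff'_mul_torus'` p700675, `detTwist_mul_torus'` p704275, `defCoeff_mul_torus'` p703816); no printed input.

THE MECHANISM.  Every factor of the product witness is RIGHT-`T′(𝔸)`-equivariant with its own place's weights, so for
`κ ∈ T′(𝔸)` **`archWitness (x κ) = Wt(κ) · archWitness x`** with the product weight character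
`torusWeight' eP′ eM′ κ := ∏_w u₀(κ)_w^{−eP′ w} u₁(κ)_w^{−eM′ w}` (`archWitness_mul_torus'`; `d3Gen_mul_torus'`,
`defCoeffProd_mul_torus'`).  In `archFactor = ∫_{T_∞} χ(a) ∫_{T′_∞} conj χ′(a′) archWitness(a⁻¹ γ₀ a′)` the inner integrand is
`conj χ′(a′) Wt(a′) · archWitness(a⁻¹ γ₀)`, hence (`integral_mul_right`, `integral_mul_left`)
**`archFactor = (∫_{T′_∞} conj χ′(a′) Wt(a′) dν′) · ∫_{T_∞} χ(a) archWitness(a⁻¹ γ₀) dν`** (`archFactor_archWitness_eq`).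
When `χ′ = Wt` on `T′_∞` (`hmatch`; the display's `_hchi' : ∀ w, ChiMatchesAt' … (eP′ w) (eM′ w) R.chi'` says exactly this
on each LOCAL torus `T′_w`, and `T′_∞` is the product of the `T′_w` — the place split, not on the tree: C-COMMON-ARCHSPLIT),
`conj χ′ · Wt = |Wt|² = 1` (`norm_torusWeight'_eq_one`) and the first factor is `ν′(T′_∞)` — positive for a Haar measure on
the compact `T′_∞`.  So **`archFactor ≠ 0`** reduces to the ONE displayed clause `∫_{T_∞} χ(a) archWitness(a⁻¹ γ₀) dν ≠ 0`
(`archFactor_archWitness_ne_zero`): the `T_∞`-Fourier coefficient of `a ↦ archWitness(a⁻¹ γ₀)` at `χ` (the FIRST torus is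
NOT diagonal in the `T′`-adapted coordinates, so no further reduction: generic non-vanishing in `γ₀`, the line's data).

WHAT IS PROVED (kernel, no print): `torusWeight'` (def), `d3Gen_mul_torus'` / `d3Gen'_mul_torus'`, `defCoeffProd_mul_torus'`,
**`archWitness_mul_torus'` / `archWitness'_mul_torus'`**, **`archFactor_archWitness_eq` / `archFactor_archWitness'_eq`**
(the factorisation, no integrability hypothesis — the identities are linear), `norm_torusWeight'_eq_one`,
`integral_conj_chi'_mul_torusWeight'_eq` (`= ν′(univ)` under `hmatch`), **`archFactor_archWitness_ne_zero` /
`archFactor_archWitness'_ne_zero`**.  Nothing here says anything about the status of the Hodge conjecture for CM abelian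
varieties, which is NOT proved (HC_CM is NOT proved by anyone in this repository).
-/

set_option autoImplicit false

noncomputable section

namespace Summit.Ventures.HodgeRepro.Tier4.Line4

open Summit.Ventures.HodgeRepro.Tier4.Common Summit.Ventures.HodgeRepro.Tier4.Line1 NumberField Matrix MeasureTheory

open scoped ComplexConjugate

open scoped Classical

section RightLaws

variable {k : Type} [Field k] [NumberField k] (q : QuadData k) (a : Fin 4 → k)
  (g g' : Matrix (Fin 4) (Fin 4) k) (hgg' : g * g' = 1) (hg'g : g' * g = 1)
  (hgΩ : g * (PlaneData.mixedRow q (a 0) (a 2)).Ω = (PlaneData.mixedRow q (a 0) (a 2)).Ω * g)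
  (lam : k) (hlam : lam ≠ 0)
  (hiso : g * (PlaneData.mixedRow q (a 1) (a 3)).B * gᵀ = lam • (PlaneData.mixedRow q (a 0) (a 2)).B)
  (w₀ : InfinitePlace k) (eP' eM' : InfinitePlace k → ℤ)

/-- **the product weight character of `T′(𝔸)`**: `Wt(κ) := ∏_w u₀(κ)_w^{−eP′ w} · u₁(κ)_w^{−eM′ w}`
(`u_j(κ)_w = weightAt' … w … j κ`). -/
def torusWeight' (κ : GA ((PlaneData.mixedRow q (a 0) (a 2)).withTransportedTorus g g' hgg' hg'g hgΩ)) : ℂ :=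
  ∏ w : InfinitePlace k,
    (weightAt' ((PlaneData.mixedRow q (a 0) (a 2)).withTransportedTorus g g' hgg' hg'g hgΩ) q w g g' 0 κ ^ (-eP' w) *
      weightAt' ((PlaneData.mixedRow q (a 0) (a 2)).withTransportedTorus g g' hgg' hg'g hgΩ) q w g g' 1 κ ^ (-eM' w))

include hlam in
/-- **the right `T′(𝔸)`-law of `d3Gen m`**: `d3Gen m (x κ) = u₀(κ)^{−(m + 3)} u₁(κ)^{−m} · d3Gen m x`. -/
theorem d3Gen_mul_torus' (hw : w₀.IsReal) (hcm : IsCMAt q w₀) (ha1 : a 1 ≠ 0) (ha3 : a 3 ≠ 0) (m : ℤ)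
    (x κ : GA ((PlaneData.mixedRow q (a 0) (a 2)).withTransportedTorus g g' hgg' hg'g hgΩ))
    (hκ : κ ∈ torusT' ((PlaneData.mixedRow q (a 0) (a 2)).withTransportedTorus g g' hgg' hg'g hgΩ)) :
    d3Gen q a g g' hgg' hg'g hgΩ lam hiso w₀ m (x * κ) =
      weightAt' ((PlaneData.mixedRow q (a 0) (a 2)).withTransportedTorus g g' hgg' hg'g hgΩ) q w₀ g g' 0 κ ^ (-(m + 3)) *
        weightAt' ((PlaneData.mixedRow q (a 0) (a 2)).withTransportedTorus g g' hgg' hg'g hgΩ) q w₀ g g' 1 κ ^ (-m) *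
        d3Gen q a g g' hgg' hg'g hgΩ lam hiso w₀ m x := by
  have hn0 := weightAt'_ne_zero_of_mem_torusT' q a g g' hgg' hg'g hgΩ lam hlam hiso w₀ hw hcm ha1 ha3 0 hκ
  rw [d3Gen_apply, d3Gen_apply, D3coeff'_mul_torus' q a g g' hgg' hg'g hgΩ lam hlam hiso w₀ hw hcm ha1 ha3 x κ hκ,
    detTwist_mul_torus' q a g g' hgg' hg'g hgΩ lam hlam hiso w₀ hw hcm ha1 ha3 m x κ hκ, neg_add, zpow_add₀ hn0,
    inv_pow, ← zpow_natCast, ← _root_.zpow_neg]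
  push_cast
  ring

include hlam in
/-- **the right `T′(𝔸)`-law of `d3Gen' p`**: `d3Gen' p (x κ) = u₀(κ)^{−p} u₁(κ)^{−(p + 3)} · d3Gen' p x`. -/
theorem d3Gen'_mul_torus' (hw : w₀.IsReal) (hcm : IsCMAt q w₀) (ha1 : a 1 ≠ 0) (ha3 : a 3 ≠ 0) (p : ℤ)
    (x κ : GA ((PlaneData.mixedRow q (a 0) (a 2)).withTransportedTorus g g' hgg' hg'g hgΩ))
    (hκ : κ ∈ torusT' ((PlaneData.mixedRow q (a 0) (a 2)).withTransportedTorus g g' hgg' hg'g hgΩ)) :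
    d3Gen' q a g g' hgg' hg'g hgΩ lam hiso w₀ p (x * κ) =
      weightAt' ((PlaneData.mixedRow q (a 0) (a 2)).withTransportedTorus g g' hgg' hg'g hgΩ) q w₀ g g' 0 κ ^ (-p) *
        weightAt' ((PlaneData.mixedRow q (a 0) (a 2)).withTransportedTorus g g' hgg' hg'g hgΩ) q w₀ g g' 1 κ ^ (-(p + 3)) *
        d3Gen' q a g g' hgg' hg'g hgΩ lam hiso w₀ p x := by
  have hn1 := weightAt'_ne_zero_of_mem_torusT' q a g g' hgg' hg'g hgΩ lam hlam hiso w₀ hw hcm ha1 ha3 1 hκ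
  rw [d3Gen'_apply, d3Gen'_apply, D3coeff''_mul_torus' q a g g' hgg' hg'g hgΩ lam hlam hiso w₀ hw hcm ha1 ha3 x κ hκ,
    detTwist_mul_torus' q a g g' hgg' hg'g hgΩ lam hlam hiso w₀ hw hcm ha1 ha3 p x κ hκ, neg_add, zpow_add₀ hn1,
    inv_pow, ← zpow_natCast, ← _root_.zpow_neg]
  push_cast
  ring

include hlam in
/-- **the right `T′(𝔸)`-law of the definite product**:
`defCoeffProd (x κ) = (∏_{w′ ≠ w₀} u₀(κ)_{w′}^{−eP′ w′} u₁(κ)_{w′}^{−eM′ w′}) · defCoeffProd x`. -/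
theorem defCoeffProd_mul_torus' (hdef : ∀ w' : InfinitePlace k, w' ≠ w₀ → w'.IsReal ∧ IsCMAt q w')
    (ha1 : a 1 ≠ 0) (ha3 : a 3 ≠ 0)
    (x κ : GA ((PlaneData.mixedRow q (a 0) (a 2)).withTransportedTorus g g' hgg' hg'g hgΩ))
    (hκ : κ ∈ torusT' ((PlaneData.mixedRow q (a 0) (a 2)).withTransportedTorus g g' hgg' hg'g hgΩ)) :
    defCoeffProd q a g g' hgg' hg'g hgΩ lam hiso w₀ eP' eM' (x * κ) =
      (∏ w' ∈ Finset.univ.erase w₀,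
        (weightAt' ((PlaneData.mixedRow q (a 0) (a 2)).withTransportedTorus g g' hgg' hg'g hgΩ) q w' g g' 0 κ ^ (-eP' w') *
          weightAt' ((PlaneData.mixedRow q (a 0) (a 2)).withTransportedTorus g g' hgg' hg'g hgΩ) q w' g g' 1 κ ^ (-eM' w'))) *
        defCoeffProd q a g g' hgg' hg'g hgΩ lam hiso w₀ eP' eM' x := by
  unfold defCoeffProd
  rw [← Finset.prod_mul_distrib]
  refine Finset.prod_congr rfl fun w' hw' => ?_
  obtain ⟨hr, hcm⟩ := hdef w' (Finset.ne_of_mem_erase hw')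
  exact defCoeff_mul_torus' q a g g' hgg' hg'g hgΩ lam hlam hiso w' hr hcm ha1 ha3 _ _ x κ hκ

include hlam in
/-- **THE RIGHT `T′(𝔸)`-LAW OF `archWitness`**: `archWitness (x κ) = Wt(κ) · archWitness x` (`he : eP′ w₀ = eM′ w₀ + 3`). -/
theorem archWitness_mul_torus' (hw₀ : w₀.IsReal) (hcm₀ : IsCMAt q w₀) (ha1 : a 1 ≠ 0) (ha3 : a 3 ≠ 0)
    (hdef : ∀ w' : InfinitePlace k, w' ≠ w₀ → w'.IsReal ∧ IsCMAt q w') (he : eP' w₀ = eM' w₀ + 3)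
    (x κ : GA ((PlaneData.mixedRow q (a 0) (a 2)).withTransportedTorus g g' hgg' hg'g hgΩ))
    (hκ : κ ∈ torusT' ((PlaneData.mixedRow q (a 0) (a 2)).withTransportedTorus g g' hgg' hg'g hgΩ)) :
    archWitness q a g g' hgg' hg'g hgΩ lam hiso w₀ eP' eM' (x * κ) =
      torusWeight' q a g g' hgg' hg'g hgΩ eP' eM' κ * archWitness q a g g' hgg' hg'g hgΩ lam hiso w₀ eP' eM' x := by
  unfold archWitness torusWeight'
  rw [archProd_apply, archProd_apply, d3Gen_mul_torus' q a g g' hgg' hg'g hgΩ lam hlam hiso w₀ hw₀ hcm₀ ha1 ha3 _ x κ hκ,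
    defCoeffProd_mul_torus' q a g g' hgg' hg'g hgΩ lam hlam hiso w₀ eP' eM' hdef ha1 ha3 x κ hκ,
    ← Finset.mul_prod_erase (Finset.univ : Finset (InfinitePlace k)) _ (Finset.mem_univ w₀), he]
  ring

include hlam in
/-- **THE RIGHT `T′(𝔸)`-LAW OF `archWitness'`**: `archWitness' (x κ) = Wt(κ) · archWitness' x` (`he : eM′ w₀ = eP′ w₀ + 3`). -/
theorem archWitness'_mul_torus' (hw₀ : w₀.IsReal) (hcm₀ : IsCMAt q w₀) (ha1 : a 1 ≠ 0) (ha3 : a 3 ≠ 0)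
    (hdef : ∀ w' : InfinitePlace k, w' ≠ w₀ → w'.IsReal ∧ IsCMAt q w') (he : eM' w₀ = eP' w₀ + 3)
    (x κ : GA ((PlaneData.mixedRow q (a 0) (a 2)).withTransportedTorus g g' hgg' hg'g hgΩ))
    (hκ : κ ∈ torusT' ((PlaneData.mixedRow q (a 0) (a 2)).withTransportedTorus g g' hgg' hg'g hgΩ)) :
    archWitness' q a g g' hgg' hg'g hgΩ lam hiso w₀ eP' eM' (x * κ) =
      torusWeight' q a g g' hgg' hg'g hgΩ eP' eM' κ * archWitness' q a g g' hgg' hg'g hgΩ lam hiso w₀ eP' eM' x := by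
  unfold archWitness' torusWeight'
  rw [archProd_apply, archProd_apply, d3Gen'_mul_torus' q a g g' hgg' hg'g hgΩ lam hlam hiso w₀ hw₀ hcm₀ ha1 ha3 _ x κ hκ,
    defCoeffProd_mul_torus' q a g g' hgg' hg'g hgΩ lam hlam hiso w₀ eP' eM' hdef ha1 ha3 x κ hκ,
    ← Finset.mul_prod_erase (Finset.univ : Finset (InfinitePlace k)) _ (Finset.mem_univ w₀), he]
  ring

include hlam hiso in
/-- `‖Wt(κ)‖ = 1` on `T′(𝔸)` when every infinite place is real CM (each weight is unitary). -/
theorem norm_torusWeight'_eq_one (hall : ∀ w : InfinitePlace k, w.IsReal ∧ IsCMAt q w) (ha1 : a 1 ≠ 0) (ha3 : a 3 ≠ 0)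
    {κ : GA ((PlaneData.mixedRow q (a 0) (a 2)).withTransportedTorus g g' hgg' hg'g hgΩ)}
    (hκ : κ ∈ torusT' ((PlaneData.mixedRow q (a 0) (a 2)).withTransportedTorus g g' hgg' hg'g hgΩ)) :
    ‖torusWeight' q a g g' hgg' hg'g hgΩ eP' eM' κ‖ = 1 := by
  unfold torusWeight'
  rw [norm_prod]
  refine Finset.prod_eq_one fun w _ => ?_
  rw [norm_mul, norm_zpow, norm_zpow,
    norm_weightAt'_eq_one_of_mem_torusT' q a g g' hgg' hg'g hgΩ lam hlam hiso w (hall w).1 (hall w).2 ha1 ha3 0 hκ,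
    norm_weightAt'_eq_one_of_mem_torusT' q a g g' hgg' hg'g hgΩ lam hlam hiso w (hall w).1 (hall w).2 ha1 ha3 1 hκ,
    _root_.one_zpow, _root_.one_zpow, mul_one]

end RightLaws

section Factor

variable {k : Type} [Field k] [NumberField k] (q : QuadData k) (a : Fin 4 → k)
  (g g' : Matrix (Fin 4) (Fin 4) k) (hgg' : g * g' = 1) (hg'g : g' * g = 1)
  (hgΩ : g * (PlaneData.mixedRow q (a 0) (a 2)).Ω = (PlaneData.mixedRow q (a 0) (a 2)).Ω * g)
  (lam : k) (hlam : lam ≠ 0)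
  (hiso : g * (PlaneData.mixedRow q (a 1) (a 3)).B * gᵀ = lam • (PlaneData.mixedRow q (a 0) (a 2)).B)
  [MeasurableSpace (GA ((PlaneData.mixedRow q (a 0) (a 2)).withTransportedTorus g g' hgg' hg'g hgΩ))]
  (R : RTFData ((PlaneData.mixedRow q (a 0) (a 2)).withTransportedTorus g g' hgg' hg'g hgΩ))
  (w₀ : InfinitePlace k) (eP' eM' : InfinitePlace k → ℤ)
  (γ₀ : GA ((PlaneData.mixedRow q (a 0) (a 2)).withTransportedTorus g g' hgg' hg'g hgΩ))
  (νinf : Measure (torusInf ((PlaneData.mixedRow q (a 0) (a 2)).withTransportedTorus g g' hgg' hg'g hgΩ)))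
  (νinf' : Measure (torusInf' ((PlaneData.mixedRow q (a 0) (a 2)).withTransportedTorus g g' hgg' hg'g hgΩ)))

/-- the factorisation of `archFactor` for a right-`T′(𝔸)`-equivariant `finf` with weight character `Wt`
(pure linearity of the integral: no integrability hypothesis). -/
theorem archFactor_eq_of_mul_torus' (finf : GA ((PlaneData.mixedRow q (a 0) (a 2)).withTransportedTorus g g' hgg' hg'g hgΩ) → ℂ)
    (Wt : GA ((PlaneData.mixedRow q (a 0) (a 2)).withTransportedTorus g g' hgg' hg'g hgΩ) → ℂ)
    (hlaw : ∀ x κ : GA ((PlaneData.mixedRow q (a 0) (a 2)).withTransportedTorus g g' hgg' hg'g hgΩ),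
      κ ∈ torusT' ((PlaneData.mixedRow q (a 0) (a 2)).withTransportedTorus g g' hgg' hg'g hgΩ) →
      finf (x * κ) = Wt κ * finf x) :
    L1Class.archFactor ((PlaneData.mixedRow q (a 0) (a 2)).withTransportedTorus g g' hgg' hg'g hgΩ) R finf γ₀ νinf νinf' =
      (∫ t' : torusInf' ((PlaneData.mixedRow q (a 0) (a 2)).withTransportedTorus g g' hgg' hg'g hgΩ),
          conj (R.chi' t') * Wt ((t' : torusT' ((PlaneData.mixedRow q (a 0) (a 2)).withTransportedTorus g g' hgg' hg'g hgΩ)) :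
            GA ((PlaneData.mixedRow q (a 0) (a 2)).withTransportedTorus g g' hgg' hg'g hgΩ)) ∂νinf') *
        ∫ t : torusInf ((PlaneData.mixedRow q (a 0) (a 2)).withTransportedTorus g g' hgg' hg'g hgΩ),
          R.chi t * finf (((t : torusT ((PlaneData.mixedRow q (a 0) (a 2)).withTransportedTorus g g' hgg' hg'g hgΩ)) :
            GA ((PlaneData.mixedRow q (a 0) (a 2)).withTransportedTorus g g' hgg' hg'g hgΩ))⁻¹ * γ₀) ∂νinf := by
  unfold L1Class.archFactor
  have h : ∀ (t : torusInf ((PlaneData.mixedRow q (a 0) (a 2)).withTransportedTorus g g' hgg' hg'g hgΩ))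
      (t' : torusInf' ((PlaneData.mixedRow q (a 0) (a 2)).withTransportedTorus g g' hgg' hg'g hgΩ)),
      finf (((t : torusT ((PlaneData.mixedRow q (a 0) (a 2)).withTransportedTorus g g' hgg' hg'g hgΩ)) :
          GA ((PlaneData.mixedRow q (a 0) (a 2)).withTransportedTorus g g' hgg' hg'g hgΩ))⁻¹ * γ₀ *
          ((t' : torusT' ((PlaneData.mixedRow q (a 0) (a 2)).withTransportedTorus g g' hgg' hg'g hgΩ)) :
            GA ((PlaneData.mixedRow q (a 0) (a 2)).withTransportedTorus g g' hgg' hg'g hgΩ))) =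
        Wt ((t' : torusT' ((PlaneData.mixedRow q (a 0) (a 2)).withTransportedTorus g g' hgg' hg'g hgΩ)) :
            GA ((PlaneData.mixedRow q (a 0) (a 2)).withTransportedTorus g g' hgg' hg'g hgΩ)) *
          finf (((t : torusT ((PlaneData.mixedRow q (a 0) (a 2)).withTransportedTorus g g' hgg' hg'g hgΩ)) :
            GA ((PlaneData.mixedRow q (a 0) (a 2)).withTransportedTorus g g' hgg' hg'g hgΩ))⁻¹ * γ₀) :=
    fun t t' => hlaw _ _ (t' : torusT' ((PlaneData.mixedRow q (a 0) (a 2)).withTransportedTorus g g' hgg' hg'g hgΩ)).2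
  simp_rw [h]
  have h2 : ∀ t : torusInf ((PlaneData.mixedRow q (a 0) (a 2)).withTransportedTorus g g' hgg' hg'g hgΩ),
      (∫ t' : torusInf' ((PlaneData.mixedRow q (a 0) (a 2)).withTransportedTorus g g' hgg' hg'g hgΩ),
        conj (R.chi' t') * (Wt ((t' : torusT' ((PlaneData.mixedRow q (a 0) (a 2)).withTransportedTorus g g' hgg' hg'g hgΩ)) :
            GA ((PlaneData.mixedRow q (a 0) (a 2)).withTransportedTorus g g' hgg' hg'g hgΩ)) *
          finf (((t : torusT ((PlaneData.mixedRow q (a 0) (a 2)).withTransportedTorus g g' hgg' hg'g hgΩ)) :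
            GA ((PlaneData.mixedRow q (a 0) (a 2)).withTransportedTorus g g' hgg' hg'g hgΩ))⁻¹ * γ₀)) ∂νinf') =
      (∫ t' : torusInf' ((PlaneData.mixedRow q (a 0) (a 2)).withTransportedTorus g g' hgg' hg'g hgΩ),
        conj (R.chi' t') * Wt ((t' : torusT' ((PlaneData.mixedRow q (a 0) (a 2)).withTransportedTorus g g' hgg' hg'g hgΩ)) :
            GA ((PlaneData.mixedRow q (a 0) (a 2)).withTransportedTorus g g' hgg' hg'g hgΩ)) ∂νinf') *
        finf (((t : torusT ((PlaneData.mixedRow q (a 0) (a 2)).withTransportedTorus g g' hgg' hg'g hgΩ)) :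
            GA ((PlaneData.mixedRow q (a 0) (a 2)).withTransportedTorus g g' hgg' hg'g hgΩ))⁻¹ * γ₀) := by
    intro t
    simp_rw [← mul_assoc]
    exact integral_mul_const _ _
  simp_rw [h2]
  rw [← integral_const_mul]
  congr 1
  funext t
  ring

include hlam in
/-- **THE FACTORISATION FOR `archWitness`**:
`archFactor R archWitness γ₀ ν ν′ = (∫_{T′_∞} conj χ′(a′) · Wt(a′) dν′) · ∫_{T_∞} χ(a) · archWitness(a⁻¹ γ₀) dν`. -/
theorem archFactor_archWitness_eq (hw₀ : w₀.IsReal) (hcm₀ : IsCMAt q w₀) (ha1 : a 1 ≠ 0) (ha3 : a 3 ≠ 0)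
    (hdef : ∀ w' : InfinitePlace k, w' ≠ w₀ → w'.IsReal ∧ IsCMAt q w') (he : eP' w₀ = eM' w₀ + 3) :
    L1Class.archFactor ((PlaneData.mixedRow q (a 0) (a 2)).withTransportedTorus g g' hgg' hg'g hgΩ) R
        (archWitness q a g g' hgg' hg'g hgΩ lam hiso w₀ eP' eM') γ₀ νinf νinf' =
      (∫ t' : torusInf' ((PlaneData.mixedRow q (a 0) (a 2)).withTransportedTorus g g' hgg' hg'g hgΩ),
          conj (R.chi' t') * torusWeight' q a g g' hgg' hg'g hgΩ eP' eM'
            ((t' : torusT' ((PlaneData.mixedRow q (a 0) (a 2)).withTransportedTorus g g' hgg' hg'g hgΩ)) :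
              GA ((PlaneData.mixedRow q (a 0) (a 2)).withTransportedTorus g g' hgg' hg'g hgΩ)) ∂νinf') *
        ∫ t : torusInf ((PlaneData.mixedRow q (a 0) (a 2)).withTransportedTorus g g' hgg' hg'g hgΩ),
          R.chi t * archWitness q a g g' hgg' hg'g hgΩ lam hiso w₀ eP' eM'
            (((t : torusT ((PlaneData.mixedRow q (a 0) (a 2)).withTransportedTorus g g' hgg' hg'g hgΩ)) :
              GA ((PlaneData.mixedRow q (a 0) (a 2)).withTransportedTorus g g' hgg' hg'g hgΩ))⁻¹ * γ₀) ∂νinf :=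
  archFactor_eq_of_mul_torus' q a g g' hgg' hg'g hgΩ R γ₀ νinf νinf' _ _
    (fun x κ hκ => archWitness_mul_torus' q a g g' hgg' hg'g hgΩ lam hlam hiso w₀ eP' eM' hw₀ hcm₀ ha1 ha3 hdef he x κ hκ)

include hlam in
/-- **THE FACTORISATION FOR `archWitness'`**. -/
theorem archFactor_archWitness'_eq (hw₀ : w₀.IsReal) (hcm₀ : IsCMAt q w₀) (ha1 : a 1 ≠ 0) (ha3 : a 3 ≠ 0)
    (hdef : ∀ w' : InfinitePlace k, w' ≠ w₀ → w'.IsReal ∧ IsCMAt q w') (he : eM' w₀ = eP' w₀ + 3) :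
    L1Class.archFactor ((PlaneData.mixedRow q (a 0) (a 2)).withTransportedTorus g g' hgg' hg'g hgΩ) R
        (archWitness' q a g g' hgg' hg'g hgΩ lam hiso w₀ eP' eM') γ₀ νinf νinf' =
      (∫ t' : torusInf' ((PlaneData.mixedRow q (a 0) (a 2)).withTransportedTorus g g' hgg' hg'g hgΩ),
          conj (R.chi' t') * torusWeight' q a g g' hgg' hg'g hgΩ eP' eM'
            ((t' : torusT' ((PlaneData.mixedRow q (a 0) (a 2)).withTransportedTorus g g' hgg' hg'g hgΩ)) :
              GA ((PlaneData.mixedRow q (a 0) (a 2)).withTransportedTorus g g' hgg' hg'g hgΩ)) ∂νinf') *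
        ∫ t : torusInf ((PlaneData.mixedRow q (a 0) (a 2)).withTransportedTorus g g' hgg' hg'g hgΩ),
          R.chi t * archWitness' q a g g' hgg' hg'g hgΩ lam hiso w₀ eP' eM'
            (((t : torusT ((PlaneData.mixedRow q (a 0) (a 2)).withTransportedTorus g g' hgg' hg'g hgΩ)) :
              GA ((PlaneData.mixedRow q (a 0) (a 2)).withTransportedTorus g g' hgg' hg'g hgΩ))⁻¹ * γ₀) ∂νinf :=
  archFactor_eq_of_mul_torus' q a g g' hgg' hg'g hgΩ R γ₀ νinf νinf' _ _
    (fun x κ hκ => archWitness'_mul_torus' q a g g' hgg' hg'g hgΩ lam hlam hiso w₀ eP' eM' hw₀ hcm₀ ha1 ha3 hdef he x κ hκ)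

include hlam hiso in
/-- **the character sum under the matching `χ′ = Wt` on `T′_∞`**: `∫_{T′_∞} conj χ′(a′) · Wt(a′) dν′ = ν′(T′_∞)`
(`conj Wt · Wt = |Wt|² = 1`; every place real CM). -/
theorem integral_conj_chi'_mul_torusWeight'_eq (hall : ∀ w : InfinitePlace k, w.IsReal ∧ IsCMAt q w)
    (ha1 : a 1 ≠ 0) (ha3 : a 3 ≠ 0)
    (hmatch : ∀ t' : torusInf' ((PlaneData.mixedRow q (a 0) (a 2)).withTransportedTorus g g' hgg' hg'g hgΩ),
      R.chi' t' = torusWeight' q a g g' hgg' hg'g hgΩ eP' eM'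
        ((t' : torusT' ((PlaneData.mixedRow q (a 0) (a 2)).withTransportedTorus g g' hgg' hg'g hgΩ)) :
          GA ((PlaneData.mixedRow q (a 0) (a 2)).withTransportedTorus g g' hgg' hg'g hgΩ))) :
    (∫ t' : torusInf' ((PlaneData.mixedRow q (a 0) (a 2)).withTransportedTorus g g' hgg' hg'g hgΩ),
        conj (R.chi' t') * torusWeight' q a g g' hgg' hg'g hgΩ eP' eM'
          ((t' : torusT' ((PlaneData.mixedRow q (a 0) (a 2)).withTransportedTorus g g' hgg' hg'g hgΩ)) :
            GA ((PlaneData.mixedRow q (a 0) (a 2)).withTransportedTorus g g' hgg' hg'g hgΩ)) ∂νinf') =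
      ((νinf' Set.univ).toReal : ℂ) := by
  have h1 : ∀ t' : torusInf' ((PlaneData.mixedRow q (a 0) (a 2)).withTransportedTorus g g' hgg' hg'g hgΩ),
      conj (R.chi' t') * torusWeight' q a g g' hgg' hg'g hgΩ eP' eM'
        ((t' : torusT' ((PlaneData.mixedRow q (a 0) (a 2)).withTransportedTorus g g' hgg' hg'g hgΩ)) :
          GA ((PlaneData.mixedRow q (a 0) (a 2)).withTransportedTorus g g' hgg' hg'g hgΩ)) = 1 := by
    intro t'
    rw [hmatch t', ← Complex.normSq_eq_conj_mul_self, Complex.normSq_eq_norm_sq,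
      norm_torusWeight'_eq_one q a g g' hgg' hg'g hgΩ lam hlam hiso eP' eM' hall ha1 ha3
        (t' : torusT' ((PlaneData.mixedRow q (a 0) (a 2)).withTransportedTorus g g' hgg' hg'g hgΩ)).2]
    simp
  simp_rw [h1]
  rw [integral_const, Complex.real_smul, mul_one, measureReal_def]

include hlam in
/-- **`arch_ne` FOR `archWitness`, REDUCED**: under the matching `χ′ = Wt` on `T′_∞`, a measure `ν′` of positive finite
total mass, and the ONE displayed clause `∫_{T_∞} χ(a) · archWitness(a⁻¹ γ₀) dν ≠ 0` (the `T_∞`-Fourier coefficient),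
`archFactor R archWitness γ₀ ν ν′ ≠ 0`. -/
theorem archFactor_archWitness_ne_zero (hall : ∀ w : InfinitePlace k, w.IsReal ∧ IsCMAt q w) (ha1 : a 1 ≠ 0)
    (ha3 : a 3 ≠ 0) (he : eP' w₀ = eM' w₀ + 3)
    (hmatch : ∀ t' : torusInf' ((PlaneData.mixedRow q (a 0) (a 2)).withTransportedTorus g g' hgg' hg'g hgΩ),
      R.chi' t' = torusWeight' q a g g' hgg' hg'g hgΩ eP' eM'
        ((t' : torusT' ((PlaneData.mixedRow q (a 0) (a 2)).withTransportedTorus g g' hgg' hg'g hgΩ)) :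
          GA ((PlaneData.mixedRow q (a 0) (a 2)).withTransportedTorus g g' hgg' hg'g hgΩ)))
    (hvol : (νinf' Set.univ).toReal ≠ 0)
    (hF : (∫ t : torusInf ((PlaneData.mixedRow q (a 0) (a 2)).withTransportedTorus g g' hgg' hg'g hgΩ),
        R.chi t * archWitness q a g g' hgg' hg'g hgΩ lam hiso w₀ eP' eM'
          (((t : torusT ((PlaneData.mixedRow q (a 0) (a 2)).withTransportedTorus g g' hgg' hg'g hgΩ)) :
            GA ((PlaneData.mixedRow q (a 0) (a 2)).withTransportedTorus g g' hgg' hg'g hgΩ))⁻¹ * γ₀) ∂νinf) ≠ 0) :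
    L1Class.archFactor ((PlaneData.mixedRow q (a 0) (a 2)).withTransportedTorus g g' hgg' hg'g hgΩ) R
      (archWitness q a g g' hgg' hg'g hgΩ lam hiso w₀ eP' eM') γ₀ νinf νinf' ≠ 0 := by
  rw [archFactor_archWitness_eq q a g g' hgg' hg'g hgΩ lam hlam hiso R w₀ eP' eM' γ₀ νinf νinf' (hall w₀).1 (hall w₀).2
      ha1 ha3 (fun w' _ => hall w') he,
    integral_conj_chi'_mul_torusWeight'_eq q a g g' hgg' hg'g hgΩ lam hlam hiso R eP' eM' νinf' hall ha1 ha3 hmatch]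
  exact mul_ne_zero (by exact_mod_cast hvol) hF

include hlam in
/-- **`arch_ne` FOR `archWitness'`, REDUCED** (the same with `he : eM′ w₀ = eP′ w₀ + 3`). -/
theorem archFactor_archWitness'_ne_zero (hall : ∀ w : InfinitePlace k, w.IsReal ∧ IsCMAt q w) (ha1 : a 1 ≠ 0)
    (ha3 : a 3 ≠ 0) (he : eM' w₀ = eP' w₀ + 3)
    (hmatch : ∀ t' : torusInf' ((PlaneData.mixedRow q (a 0) (a 2)).withTransportedTorus g g' hgg' hg'g hgΩ),
      R.chi' t' = torusWeight' q a g g' hgg' hg'g hgΩ eP' eM'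
        ((t' : torusT' ((PlaneData.mixedRow q (a 0) (a 2)).withTransportedTorus g g' hgg' hg'g hgΩ)) :
          GA ((PlaneData.mixedRow q (a 0) (a 2)).withTransportedTorus g g' hgg' hg'g hgΩ)))
    (hvol : (νinf' Set.univ).toReal ≠ 0)
    (hF : (∫ t : torusInf ((PlaneData.mixedRow q (a 0) (a 2)).withTransportedTorus g g' hgg' hg'g hgΩ),
        R.chi t * archWitness' q a g g' hgg' hg'g hgΩ lam hiso w₀ eP' eM'
          (((t : torusT ((PlaneData.mixedRow q (a 0) (a 2)).withTransportedTorus g g' hgg' hg'g hgΩ)) :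
            GA ((PlaneData.mixedRow q (a 0) (a 2)).withTransportedTorus g g' hgg' hg'g hgΩ))⁻¹ * γ₀) ∂νinf) ≠ 0) :
    L1Class.archFactor ((PlaneData.mixedRow q (a 0) (a 2)).withTransportedTorus g g' hgg' hg'g hgΩ) R
      (archWitness' q a g g' hgg' hg'g hgΩ lam hiso w₀ eP' eM') γ₀ νinf νinf' ≠ 0 := by
  rw [archFactor_archWitness'_eq q a g g' hgg' hg'g hgΩ lam hlam hiso R w₀ eP' eM' γ₀ νinf νinf' (hall w₀).1 (hall w₀).2
      ha1 ha3 (fun w' _ => hall w') he,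
    integral_conj_chi'_mul_torusWeight'_eq q a g g' hgg' hg'g hgΩ lam hlam hiso R eP' eM' νinf' hall ha1 ha3 hmatch]
  exact mul_ne_zero (by exact_mod_cast hvol) hF

end Factor

end Summit.Ventures.HodgeRepro.Tier4.Line4

end
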